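import Summits.QuantumFields.YangMills.Theorems.FluctuationComparisonRegPrIntLS2BetaArgminOrbitOfTower
import Summits.QuantumFields.YangMills.Theorems.UnitScaleTiltProp7CritEL
import HarnessLib

/-!
# S2β · THE INTERIOR LEMMA FOR CRIT-m♮ — «an argmin good history is a LOCAL MINIMUM of the Wilson action on the WHOLE descent fibre» (the hypothesis the Lagrange
# step consumes), from print's (6)(ε₀)-regularity of the argmin (✓FILE D `regPr_of_argmin`) and the openness of `𝔘_k(ε₀)` (✓`Prop7CritEL.isOpen_regPr`); OUTRIGHT at `L ≥ 5`

Cell `ym3-torus` (YM ladder rung R3 = continuum `SU(2)` Yang–Mills on the three-torus at fixed lattice data — a RUNG: NOT d = 4, NOT infinite volume, NOT a mass gap,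
NOT Clay).  Width seat `ym3-torus-px5` (gen 22), pen (β) of the CRIT-m♮ split announced 12:13:26Z on the holder's word (px16 g21 12:11:53Z «CRIT-m♮ ∕ MULT♮ … yours if
you want them»); crux `stmt-QuantumFields-20520` (`…Theses.UnitScaleTilt.FluctuationComparisonRegPrIntL`), LINE g18-1 S2β, organ GAP♯∘ (registered `stub_uniformFibreGapOrbit`,
registry `Lines/semiclassical_s2beta.lean` UNTOUCHED) ⟸ (D♮) ∧ (F♮) (✓p821904), (F♮) ⟸ «CRIT♮» ∧ (BKG) (px16 g21 (3)), «CRIT♮» ⟸ «MULT♭» = CRIT-m♮ ∧ MULT♮ ∧ AVG₂♭ (px16 g21 (5)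
`…S2BetaCritPairOfMultiplier`), (BKG) ✓p822405 (this seat); `--kind proof --supports stmt-QuantumFields-20520 --as helper`, count-neutral, DEFINITION-FREE (0 `def`,
0 `instance`, 0 `notation`, 0 `sorry`, default heartbeats).

WHY.  CRIT-m♮ («`DA(U₀) = λ ∘ DM(U₀)`», constrained criticality of the argmin in multiplier form) is the Lagrange-multiplier theorem applied to the Wilson action on the
descent fibre `{U | D_{J,K}U = V}` at `U₀`, read in the right-invariant chart.  Its NON-CHART hypothesis is that `U₀` is a local extremum of `A` on the fibre — whereas the
row's argmin set only says `A(U₀) = minActionRegPr F J K ε₀ V` = the infimum over print's REGULAR fibre (6)(ε₀) = `regFibrePr F J K _ ε₀ V` ⊊ fibre.  The gap closes by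
«interior»: an argmin good history is (6)(ε₀)-regular (✓px13 g21 FILE D `regPr_of_argmin`, from the Thm-1 pair; [Balaban1985Variational] Thm 1 (8)–(10) p.279), both
clauses of (2) are STRICT inequalities of continuous functions, so `𝔘_k(ε₀)` is OPEN (✓`Prop7CritEL.isOpen_regPr`) and a whole neighbourhood of `U₀` in the fibre lies in
(6)(ε₀), where `A ≥ minActionRegPr = A(U₀)` (lit ✓`minActionRegPr_le`).

WHAT IS PROVED (sorry-free).
* §1 (ZERO Thm-1 hypotheses) ★★`isLocalMinOn_fibre_of_regPr_of_action_eq`: `U ∈ fibre`, `RegPr F J K ε₀ U`, `A(U) = minActionRegPr F J K _ ε₀ V` ⟹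
  `IsLocalMinOn wilsonAction4 (fibre F ℰp J K _ V) U`; ★`exists_nhds_forall_action_le_of_regPr_of_action_eq` (the same as an explicit neighbourhood `N ∈ 𝓝 U` with
  `∀ W ∈ N, W ∈ fibre → A U ≤ A W` — the form a chart pulls back); `isMinOn_regFibrePr_of_action_eq` (global minimum on (6)(ε₀), bookkeeping).
* §2 ★★`isLocalMinOn_fibre_of_argmin` — under FILE D §1's hypotheses (the pair at `(L, a₀, a₁, B₃)`, threshold profile `θ`), every depth `K − J ≥ 0`: an argmin good history
  is a local minimum of `A` on the fibre; `exists_nhds_forall_action_le_of_argmin` likewise.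
* §3 in the registry's prefix and interior window, for EVERY guard `G` (plumbing = FILE D's `argminRegularOrbit_at` verbatim): ★★★`argminLocalMin_at (hT) (hU1) (G)`;
  ★★★`argminLocalMin_of_thm1Pair`; `argminLocalMin_of_thm1PairAtThree`; ★★★`argminLocalMin_body_five (L) (h5 : 5 ≤ L) (G)` — OUTRIGHT, ZERO HYPOTHESES.

CONSUMER.  The CRIT-m♮ discharger (pen (α): the abstract multiplier door over Mathlib's `IsLocalExtrOn.exists_multipliers_of_hasStrictFDerivAt`) pulls §1∕§3 back along
the right-invariant chart `ζ ↦ expPoint(ζ)•U₀` to `IsLocalMinOn (A ∘ chart) {ζ | (chart-descent) ζ = (chart-descent) 0} 0`; the remaining inputs are (SUBM-m) (strict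
differentiability + surjectivity of the charted `m`-fold descent at `U₀`) and (A-C¹) — OPEN, other hands.

HONEST.  Composition BY NAME (FILE D + `isOpen_regPr` + `minActionRegPr_le`) + filter bookkeeping; nothing of Bałaban's analysis is added; CRIT-m♮, MULT♮, AVG₂♭, RINV,
(SUBM-m), «CRIT♮», (D♮)∕(F♮), GAP♯∘'s uniform order, the five REGISTERED stubs (every `L`), S2β, crux 20520, 19936, 19200 and `YM3TorusSU2` are NOT proved; no summit
statement is proved by a helper; rung R3 = SU(2) YM₃ on T³ at fixed lattice data — NOT d = 4, NOT infinite volume, NOT a mass gap, NOT Clay; the Yang–Mills mass gap is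
NOT proved.  Axioms standard.

References: T. Bałaban, CMP **102** (1985) 277–309 [Balaban1985Variational] ((2)–(8) p.278, Thm 1 (8)–(10) p.279, Prop. 7 p.299); CMP **102** (1985) 255–275 [Balaban1985UV3]
((7) p.257, (41)–(42) p.266); CMP **109** (1987) [Balaban1987RG1] ((0.21) p.256).
-/

set_option autoImplicit false

noncomputable section

namespace Summit.QuantumFields.YangMills.Theorems.FluctuationComparisonRegPrIntLS2BetaArgminLocalMinOnFibre

open Filter Topology
open Literature.MathematicalPhysics.QuantumFieldTheory.Balaban1983to89
open Literature.MathematicalPhysics.QuantumFieldTheory.Balaban1983to89.T3ContinuumYM3Torus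
open Literature.MathematicalPhysics.QuantumFieldTheory.Balaban1983to89.T3UnitLawDensityEML (ℰp)
open Literature.MathematicalPhysics.QuantumFieldTheory.Balaban1983to89.T3UnitScaleTilt
open Literature.MathematicalPhysics.QuantumFieldTheory.Balaban1983to89.T3TiltDescent
open Literature.MathematicalPhysics.QuantumFieldTheory.Balaban1983to89.T3ConstrainedMinimiser (fibre)
open Literature.MathematicalPhysics.QuantumFieldTheory.Balaban1983to89.T3DescentFibreTower
open Literature.MathematicalPhysics.QuantumFieldTheory.Balaban1983to89.T3RegularMinimiser
open Literature.MathematicalPhysics.QuantumFieldTheory.Balaban1983to89.T3PrintedRegularMinimiser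
open Literature.MathematicalPhysics.QuantumFieldTheory.Balaban1983to89.T3PrintedMinimiserExistence
open Literature.MathematicalPhysics.QuantumFieldTheory.Balaban1983to89.T3Thm1UniquenessSchema (Thm1UniqueMinOrbitAt)
open Literature.MathematicalPhysics.QuantumFieldTheory.Balaban1983to89.T3MinimiserStabilityReduction (θBal_pos)
open Literature.MathematicalPhysics.QuantumFieldTheory.Balaban1983to89.T3ThresholdSmallness (exists_forall_θBal_le)
open Literature.MathematicalPhysics.QuantumFieldTheory.Balaban1983to89.T4Continuum
open Summit.QuantumFields.YangMills.Theorems.FluctuationComparisonRegPrIntLS2BetaSymmetriesLiftOfCritical (thm1Pair_five thm1Pair_allL_of_three)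
open Summit.QuantumFields.YangMills.Theorems.FluctuationComparisonRegPrIntLS2BetaArgminOrbitOfTower (regPr_of_argmin)
open Summit.QuantumFields.YangMills.Theorems.Prop7CritEL (isOpen_regPr)

/-! ## §1 Local minimality on the whole fibre from (6)(ε₀)-regularity — zero Thm-1 hypotheses -/

section Interior

variable {F : T3Family}

/-- Bookkeeping: a (6)(ε₀)-regular fibre point whose action equals `minActionRegPr` MINIMISES the action over print's regular fibre (6)(ε₀).
[cite: Balaban1985Variational, Thm 1 (8) p.279, (6) p.278] -/
theorem isMinOn_regFibrePr_of_action_eq {J K : ℕ} (hJK : J ≤ K) {ε₀ : ℝ}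
    {V : GaugeField (F.P J) 0 (Matrix.specialUnitaryGroup (Fin 2) ℂ)} {U : GaugeField (F.P K) 0 (Matrix.specialUnitaryGroup (Fin 2) ℂ)}
    (hA : wilsonAction4 U = minActionRegPr F J K hJK ε₀ V) :
    IsMinOn (fun W : GaugeField (F.P K) 0 (Matrix.specialUnitaryGroup (Fin 2) ℂ) => wilsonAction4 W) (regFibrePr F J K hJK ε₀ V) U := by
  intro W hW
  show wilsonAction4 U ≤ wilsonAction4 W
  rw [hA]
  exact minActionRegPr_le F hW

/-- ★ **THE INTERIOR NEIGHBOURHOOD**: if `U` is (6)(ε₀)-regular and `A(U) = minActionRegPr F J K ε₀ V`, there is a neighbourhood `N` of `U` in `SU(2)^{bonds}` on whose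
intersection with the descent fibre of `V` the action is `≥ A(U)` — `𝔘_k(ε₀)` is open (both clauses of (2) strict) and `A ≥ minActionRegPr` on (6)(ε₀).
[cite: Balaban1985Variational, (2) p.278, (6) p.278, Thm 1 (8) p.279] -/
theorem exists_nhds_forall_action_le_of_regPr_of_action_eq {J K : ℕ} (hJK : J ≤ K) {ε₀ : ℝ}
    {V : GaugeField (F.P J) 0 (Matrix.specialUnitaryGroup (Fin 2) ℂ)} {U : GaugeField (F.P K) 0 (Matrix.specialUnitaryGroup (Fin 2) ℂ)}
    (hreg : RegPr F J K ε₀ U) (hA : wilsonAction4 U = minActionRegPr F J K hJK ε₀ V) :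
    ∃ N ∈ 𝓝 U, ∀ W ∈ N, W ∈ fibre F ℰp J K hJK V → wilsonAction4 U ≤ wilsonAction4 W := by
  refine ⟨{W | RegPr F J K ε₀ W}, (isOpen_regPr F J K ε₀).mem_nhds hreg, fun W hW hWf => ?_⟩
  rw [hA]
  exact minActionRegPr_le F ((mem_regFibrePr_iff F).mpr ⟨hWf, hW⟩)

/-- ★★ **LOCAL MINIMUM ON THE WHOLE FIBRE FROM (6)(ε₀)-REGULARITY** (zero Thm-1 hypotheses): a (6)(ε₀)-regular point `U` of the descent fibre of `V` with
`A(U) = minActionRegPr F J K ε₀ V` is a local minimum of the Wilson action restricted to the WHOLE fibre `{W | D_{J,K}W = V}` — the «interior» hypothesis of the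
Lagrange step (CRIT-m♮). [cite: Balaban1985Variational, (2) p.278, (6) p.278, Thm 1 (8) p.279] -/
theorem isLocalMinOn_fibre_of_regPr_of_action_eq {J K : ℕ} (hJK : J ≤ K) {ε₀ : ℝ}
    {V : GaugeField (F.P J) 0 (Matrix.specialUnitaryGroup (Fin 2) ℂ)} {U : GaugeField (F.P K) 0 (Matrix.specialUnitaryGroup (Fin 2) ℂ)}
    (hreg : RegPr F J K ε₀ U) (hA : wilsonAction4 U = minActionRegPr F J K hJK ε₀ V) :
    IsLocalMinOn (fun W : GaugeField (F.P K) 0 (Matrix.specialUnitaryGroup (Fin 2) ℂ) => wilsonAction4 W) (fibre F ℰp J K hJK V) U := by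
  obtain ⟨N, hN, h⟩ := exists_nhds_forall_action_le_of_regPr_of_action_eq hJK hreg hA
  show ∀ᶠ W in 𝓝[fibre F ℰp J K hJK V] U, wilsonAction4 U ≤ wilsonAction4 W
  filter_upwards [inter_mem_nhdsWithin (fibre F ℰp J K hJK V) hN] with W hW
  exact h W hW.2 hW.1

end Interior

/-! ## §2 The same for argmin good histories, from the Thm-1 pair (FILE D's REG-ARGMIN̄) -/

section Chain

variable {F : T3Family}

/-- ★★ **AN ARGMIN GOOD HISTORY IS A LOCAL MINIMUM OF THE ACTION ON THE WHOLE FIBRE**: under FILE D §1's hypotheses (the Thm-1 pair at `(L, a₀, a₁, B₃)`, `ε₀ ≤ a₀`,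
threshold profile `θ` with `θ i ≤ a₁`, `B₃θ_iL³ ≤ ε₀`, `4θ_iL³ < ε₀`), every depth `K − J ≥ 0`: a good history `U` over `V` with `A(U) = minActionRegPr F J K ε₀ V` is a local
minimum of `A` on `{W | D_{J,K}W = V}` (REG-ARGMIN̄ ✓`regPr_of_argmin` + §1). [cite: Balaban1985Variational, Thm 1 (8)-(10) p.279, (2)-(6) p.278] -/
theorem isLocalMinOn_fibre_of_argmin {L : ℕ} {a₀ a₁ B₃ : ℝ} (hT : Thm1GlobalMinAt L a₀ a₁ B₃) (hU1 : Thm1UniqueMinOrbitAt L a₀ a₁ B₃)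
    (hB₃ : 0 < B₃) (hFL : F.L = L) {ε₀ : ℝ} (hε₀ : 0 < ε₀) (hε₀a : ε₀ ≤ a₀) {θ : ℕ → ℝ} (hθpos : ∀ i, 0 < θ i)
    (hθa : ∀ i, θ i ≤ a₁) (hθB : ∀ i, B₃ * θ i * (F.L : ℝ) ^ 3 ≤ ε₀) (hθ4 : ∀ i, 4 * θ i * (F.L : ℝ) ^ 3 < ε₀)
    {J K : ℕ} (hJK : J ≤ K) {V : GaugeField (F.P J) 0 (Matrix.specialUnitaryGroup (Fin 2) ℂ)}
    {U : GaugeField (F.P K) 0 (Matrix.specialUnitaryGroup (Fin 2) ℂ)} (hUf : U ∈ fibre F ℰp J K hJK V) (hUg : U ∈ histGood F ℰp θ K J)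
    (hA : wilsonAction4 U = minActionRegPr F J K hJK ε₀ V) :
    IsLocalMinOn (fun W : GaugeField (F.P K) 0 (Matrix.specialUnitaryGroup (Fin 2) ℂ) => wilsonAction4 W) (fibre F ℰp J K hJK V) U :=
  isLocalMinOn_fibre_of_regPr_of_action_eq hJK
    ((mem_regFibrePr_iff F).mp (regPr_of_argmin hT hU1 hB₃ hFL hε₀ hε₀a hθpos hθa hθB hθ4 hJK hUf hUg hA)).2 hA

/-- ★ The neighbourhood form of `isLocalMinOn_fibre_of_argmin`. [cite: Balaban1985Variational, Thm 1 (8)-(10) p.279, (2)-(6) p.278] -/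
theorem exists_nhds_forall_action_le_of_argmin {L : ℕ} {a₀ a₁ B₃ : ℝ} (hT : Thm1GlobalMinAt L a₀ a₁ B₃) (hU1 : Thm1UniqueMinOrbitAt L a₀ a₁ B₃)
    (hB₃ : 0 < B₃) (hFL : F.L = L) {ε₀ : ℝ} (hε₀ : 0 < ε₀) (hε₀a : ε₀ ≤ a₀) {θ : ℕ → ℝ} (hθpos : ∀ i, 0 < θ i)
    (hθa : ∀ i, θ i ≤ a₁) (hθB : ∀ i, B₃ * θ i * (F.L : ℝ) ^ 3 ≤ ε₀) (hθ4 : ∀ i, 4 * θ i * (F.L : ℝ) ^ 3 < ε₀)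
    {J K : ℕ} (hJK : J ≤ K) {V : GaugeField (F.P J) 0 (Matrix.specialUnitaryGroup (Fin 2) ℂ)}
    {U : GaugeField (F.P K) 0 (Matrix.specialUnitaryGroup (Fin 2) ℂ)} (hUf : U ∈ fibre F ℰp J K hJK V) (hUg : U ∈ histGood F ℰp θ K J)
    (hA : wilsonAction4 U = minActionRegPr F J K hJK ε₀ V) :
    ∃ N ∈ 𝓝 U, ∀ W ∈ N, W ∈ fibre F ℰp J K hJK V → wilsonAction4 U ≤ wilsonAction4 W :=
  exists_nhds_forall_action_le_of_regPr_of_action_eq hJK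
    ((mem_regFibrePr_iff F).mp (regPr_of_argmin hT hU1 hB₃ hFL hε₀ hε₀a hθpos hθa hθB hθ4 hJK hUf hUg hA)).2 hA

end Chain

/-! ## §3 In the registry's prefix and interior window — at one block size from the pair there; at every `L` from the pair letter; from `L = 3` alone; OUTRIGHT at `L ≥ 5` -/

section Window

/-- ★★★ **«EVERY ARGMIN GOOD HISTORY IS A LOCAL MINIMUM OF `A` ON ITS FIBRE» AT ONE BLOCK SIZE FROM THE THM-1 PAIR AT THAT BLOCK SIZE**, for every guard `G`
(`c₀ := 1`, `pS := 0`, `ε₁ := a₀`, `γ₁` so that `θBal(b₀)(i) ≤ min a₁ (ε₀∕(2(4+B₃)L³))` — FILE D's choice verbatim). [cite: Balaban1985Variational, Thm 1 (8)-(10) p.279, (2)-(6) p.278; Balaban1985UV3, (7) p.257] -/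
theorem argminLocalMin_at {L : ℕ} (hL1 : 1 < L) {a₀ a₁ B₃ : ℝ} (ha₀ : 0 < a₀) (ha₁ : 0 < a₁) (hB₃ : 0 < B₃)
    (hT : Thm1GlobalMinAt L a₀ a₁ B₃) (hU1 : Thm1UniqueMinOrbitAt L a₀ a₁ B₃)
    (G : (F : T3Family) → (J : ℕ) → GaugeField (F.P J) 0 (Matrix.specialUnitaryGroup (Fin 2) ℂ) → Prop) :
    ∃ c₀ : ℝ, 0 < c₀ ∧ c₀ ≤ 1 ∧ ∀ (cw : ℝ), 0 < cw → cw ≤ c₀ → ∃ pS : ℝ, ∀ (b₀ p₀ : ℝ), 0 < b₀ → pS ≤ p₀ → 0 < p₀ → ∃ ε₁ : ℝ, 0 < ε₁ ∧ ∀ (ε₀ : ℝ), 0 < ε₀ → ε₀ ≤ ε₁ →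
    ∃ γ₁ : ℝ, 0 < γ₁ ∧ ∀ (F : T3Family) (γ : ℝ), F.L = L → 0 < γ → γ ≤ γ₁ →
      ∀ (J K : ℕ) (hJK : J ≤ K) (V : GaugeField (F.P J) 0 (Matrix.specialUnitaryGroup (Fin 2) ℂ)), PlaqSmall (θBal F.L γ (cw * b₀) p₀ J) V →
        G F J V →
        ∀ U₀ ∈ {U' : GaugeField (F.P K) 0 (Matrix.specialUnitaryGroup (Fin 2) ℂ) | U' ∈ fibre F ℰp J K hJK V ∧ U' ∈ histGood F ℰp (θBal F.L γ b₀ p₀) K J ∧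
            wilsonAction4 U' = minActionRegPr F J K hJK ε₀ V},
        IsLocalMinOn (fun W : GaugeField (F.P K) 0 (Matrix.specialUnitaryGroup (Fin 2) ℂ) => wilsonAction4 W) (fibre F ℰp J K hJK V) U₀ := by
  have hL : 1 ≤ L := hL1.le
  have hL0 : (0 : ℝ) < (L : ℝ) := by exact_mod_cast (show 0 < L by omega)
  refine ⟨1, one_pos, le_rfl, fun cw hcw0 hcw1 => ⟨0, fun b₀ p₀ hb _ hp => ⟨a₀, ha₀, fun ε₀ hε₀ hε₀a => ?_⟩⟩⟩
  set c : ℝ := 2 * (4 + B₃) * (L : ℝ) ^ 3 with hc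
  have hcpos : 0 < c := by positivity
  obtain ⟨γθ, hγθ, Hθ⟩ := exists_forall_θBal_le hL b₀ p₀ (lt_min ha₁ (div_pos hε₀ hcpos))
  refine ⟨min γθ 1, lt_min hγθ one_pos, fun F γ hFL hγ hγle J K hJK V _ _ U₀ hU₀ => ?_⟩
  have hγθ' : γ ≤ γθ := hγle.trans (min_le_left _ _)
  have hγ1 : γ ≤ 1 := hγle.trans (min_le_right _ _)
  have hθle : ∀ i, θBal F.L γ b₀ p₀ i ≤ min a₁ (ε₀ / c) := fun i => by rw [hFL]; exact Hθ γ hγ hγθ' i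
  have hθpos : ∀ i, 0 < θBal F.L γ b₀ p₀ i := fun i => θBal_pos F.hL.2.le hγ hγ1 hb p₀ i
  have hθa : ∀ i, θBal F.L γ b₀ p₀ i ≤ a₁ := fun i => (hθle i).trans (min_le_left _ _)
  have hθc : ∀ i, θBal F.L γ b₀ p₀ i * c ≤ ε₀ := fun i => by
    have h := (hθle i).trans (min_le_right _ _)
    rwa [le_div_iff₀ hcpos] at h
  have hFL3 : (F.L : ℝ) ^ 3 = (L : ℝ) ^ 3 := by rw [hFL]
  have hθB : ∀ i, B₃ * θBal F.L γ b₀ p₀ i * (F.L : ℝ) ^ 3 ≤ ε₀ := fun i => by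
    have h1 : B₃ * (F.L : ℝ) ^ 3 ≤ c := by rw [hFL3, hc]; nlinarith [pow_pos hL0 3]
    calc B₃ * θBal F.L γ b₀ p₀ i * (F.L : ℝ) ^ 3 = θBal F.L γ b₀ p₀ i * (B₃ * (F.L : ℝ) ^ 3) := by ring
      _ ≤ θBal F.L γ b₀ p₀ i * c := mul_le_mul_of_nonneg_left h1 (hθpos i).le
      _ ≤ ε₀ := hθc i
  have hθ4 : ∀ i, 4 * θBal F.L γ b₀ p₀ i * (F.L : ℝ) ^ 3 < ε₀ := fun i => by
    have h1 : 4 * (F.L : ℝ) ^ 3 < c := by rw [hFL3, hc]; nlinarith [pow_pos hL0 3]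
    calc 4 * θBal F.L γ b₀ p₀ i * (F.L : ℝ) ^ 3 = θBal F.L γ b₀ p₀ i * (4 * (F.L : ℝ) ^ 3) := by ring
      _ < θBal F.L γ b₀ p₀ i * c := mul_lt_mul_of_pos_left h1 (hθpos i)
      _ ≤ ε₀ := hθc i
  exact isLocalMinOn_fibre_of_argmin hT hU1 hB₃ hFL hε₀ hε₀a hθpos hθa hθB hθ4 hJK hU₀.1 hU₀.2.1 hU₀.2.2

/-- ★★★ **THE SAME AT EVERY BLOCK SIZE FROM THE THM-1 PAIR LETTER** (even ∕ `L ≤ 1` vacuous by `F.hL`), for every guard `G`. [cite: Balaban1985Variational, Thm 1 (8)-(10) p.279, (2)-(6) p.278] -/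
theorem argminLocalMin_of_thm1Pair
    (hT : ∀ L : ℕ, Odd L → 1 < L → ∃ a₀ a₁ B₃ : ℝ, 0 < a₀ ∧ 0 < a₁ ∧ 0 < B₃ ∧ Thm1GlobalMinAt L a₀ a₁ B₃ ∧ Thm1UniqueMinOrbitAt L a₀ a₁ B₃)
    (G : (F : T3Family) → (J : ℕ) → GaugeField (F.P J) 0 (Matrix.specialUnitaryGroup (Fin 2) ℂ) → Prop) :
    ∀ (L : ℕ), ∃ c₀ : ℝ, 0 < c₀ ∧ c₀ ≤ 1 ∧ ∀ (cw : ℝ), 0 < cw → cw ≤ c₀ → ∃ pS : ℝ, ∀ (b₀ p₀ : ℝ), 0 < b₀ → pS ≤ p₀ → 0 < p₀ → ∃ ε₁ : ℝ, 0 < ε₁ ∧ ∀ (ε₀ : ℝ), 0 < ε₀ → ε₀ ≤ ε₁ →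
    ∃ γ₁ : ℝ, 0 < γ₁ ∧ ∀ (F : T3Family) (γ : ℝ), F.L = L → 0 < γ → γ ≤ γ₁ →
      ∀ (J K : ℕ) (hJK : J ≤ K) (V : GaugeField (F.P J) 0 (Matrix.specialUnitaryGroup (Fin 2) ℂ)), PlaqSmall (θBal F.L γ (cw * b₀) p₀ J) V →
        G F J V →
        ∀ U₀ ∈ {U' : GaugeField (F.P K) 0 (Matrix.specialUnitaryGroup (Fin 2) ℂ) | U' ∈ fibre F ℰp J K hJK V ∧ U' ∈ histGood F ℰp (θBal F.L γ b₀ p₀) K J ∧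
            wilsonAction4 U' = minActionRegPr F J K hJK ε₀ V},
        IsLocalMinOn (fun W : GaugeField (F.P K) 0 (Matrix.specialUnitaryGroup (Fin 2) ℂ) => wilsonAction4 W) (fibre F ℰp J K hJK V) U₀ := by
  intro L
  by_cases hLodd : Odd L ∧ 1 < L
  · obtain ⟨a₀, a₁, B₃, ha₀, ha₁, hB₃, hT1, hU1⟩ := hT L hLodd.1 hLodd.2
    exact argminLocalMin_at hLodd.2 ha₀ ha₁ hB₃ hT1 hU1 G
  · refine ⟨1, one_pos, le_rfl, fun cw _ _ => ⟨0, fun b₀ p₀ _ _ _ => ⟨1, one_pos, fun ε₀ _ _ => ⟨1, one_pos, ?_⟩⟩⟩⟩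
    intro F γ hFL
    exact absurd (hFL ▸ F.hL) hLodd

/-- ★★★ **… FROM THE `L = 3` THM-1 PAIR ALONE** (every `L ≥ 5` by ✓`thm1Pair_five`; `L = 3` = the [Balaban1985RegularSpaces] Thm-2 socket, EMBARGO-LITE №58).
[cite: Balaban1985Variational, Thm 1 p.279; Balaban1985RegularSpaces, Thm 2 p.83] -/
theorem argminLocalMin_of_thm1PairAtThree
    (h3 : ∃ a₀ a₁ B₃ : ℝ, 0 < a₀ ∧ 0 < a₁ ∧ 0 < B₃ ∧ Thm1GlobalMinAt 3 a₀ a₁ B₃ ∧ Thm1UniqueMinOrbitAt 3 a₀ a₁ B₃)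
    (G : (F : T3Family) → (J : ℕ) → GaugeField (F.P J) 0 (Matrix.specialUnitaryGroup (Fin 2) ℂ) → Prop) :
    ∀ (L : ℕ), ∃ c₀ : ℝ, 0 < c₀ ∧ c₀ ≤ 1 ∧ ∀ (cw : ℝ), 0 < cw → cw ≤ c₀ → ∃ pS : ℝ, ∀ (b₀ p₀ : ℝ), 0 < b₀ → pS ≤ p₀ → 0 < p₀ → ∃ ε₁ : ℝ, 0 < ε₁ ∧ ∀ (ε₀ : ℝ), 0 < ε₀ → ε₀ ≤ ε₁ →
    ∃ γ₁ : ℝ, 0 < γ₁ ∧ ∀ (F : T3Family) (γ : ℝ), F.L = L → 0 < γ → γ ≤ γ₁ →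
      ∀ (J K : ℕ) (hJK : J ≤ K) (V : GaugeField (F.P J) 0 (Matrix.specialUnitaryGroup (Fin 2) ℂ)), PlaqSmall (θBal F.L γ (cw * b₀) p₀ J) V →
        G F J V →
        ∀ U₀ ∈ {U' : GaugeField (F.P K) 0 (Matrix.specialUnitaryGroup (Fin 2) ℂ) | U' ∈ fibre F ℰp J K hJK V ∧ U' ∈ histGood F ℰp (θBal F.L γ b₀ p₀) K J ∧
            wilsonAction4 U' = minActionRegPr F J K hJK ε₀ V},
        IsLocalMinOn (fun W : GaugeField (F.P K) 0 (Matrix.specialUnitaryGroup (Fin 2) ℂ) => wilsonAction4 W) (fibre F ℰp J K hJK V) U₀ :=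
  argminLocalMin_of_thm1Pair (thm1Pair_allL_of_three h3) G

/-- ★★★ **«EVERY ARGMIN GOOD HISTORY IS A LOCAL MINIMUM OF `A` ON ITS FIBRE» ON THE INTERIOR WINDOW AT EVERY BLOCK SIZE `L ≥ 5` — ZERO HYPOTHESES**
(✓`thm1Pair_five` ∘ `argminLocalMin_at`). [cite: Balaban1985Variational, Thm 1 (8)-(10) p.279, Prop. 7 p.299] -/
theorem argminLocalMin_body_five (L : ℕ) (h5 : 5 ≤ L)
    (G : (F : T3Family) → (J : ℕ) → GaugeField (F.P J) 0 (Matrix.specialUnitaryGroup (Fin 2) ℂ) → Prop) :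
    ∃ c₀ : ℝ, 0 < c₀ ∧ c₀ ≤ 1 ∧ ∀ (cw : ℝ), 0 < cw → cw ≤ c₀ → ∃ pS : ℝ, ∀ (b₀ p₀ : ℝ), 0 < b₀ → pS ≤ p₀ → 0 < p₀ → ∃ ε₁ : ℝ, 0 < ε₁ ∧ ∀ (ε₀ : ℝ), 0 < ε₀ → ε₀ ≤ ε₁ →
    ∃ γ₁ : ℝ, 0 < γ₁ ∧ ∀ (F : T3Family) (γ : ℝ), F.L = L → 0 < γ → γ ≤ γ₁ →
      ∀ (J K : ℕ) (hJK : J ≤ K) (V : GaugeField (F.P J) 0 (Matrix.specialUnitaryGroup (Fin 2) ℂ)), PlaqSmall (θBal F.L γ (cw * b₀) p₀ J) V →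
        G F J V →
        ∀ U₀ ∈ {U' : GaugeField (F.P K) 0 (Matrix.specialUnitaryGroup (Fin 2) ℂ) | U' ∈ fibre F ℰp J K hJK V ∧ U' ∈ histGood F ℰp (θBal F.L γ b₀ p₀) K J ∧
            wilsonAction4 U' = minActionRegPr F J K hJK ε₀ V},
        IsLocalMinOn (fun W : GaugeField (F.P K) 0 (Matrix.specialUnitaryGroup (Fin 2) ℂ) => wilsonAction4 W) (fibre F ℰp J K hJK V) U₀ := by
  obtain ⟨a₀, a₁, B₃, ha₀, ha₁, hB₃, hT1, hU1⟩ := thm1Pair_five L h5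
  exact argminLocalMin_at (by omega) ha₀ ha₁ hB₃ hT1 hU1 G

end Window

end Summit.QuantumFields.YangMills.Theorems.FluctuationComparisonRegPrIntLS2BetaArgminLocalMinOnFibre

end
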